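import Summits.CriticalPhenomena.PercolationContinuityZ3.Theorems.PercNearOneGluingNoHeavyLowerTailThreePartitionRobustStepUntwisted

/-!
# THEOREM A: the one-sided robust three-partition matching (lineage `prim-bnk-2`, generation 25)

Support file (`--supports stmt-CriticalPhenomena-4575`; memo `FROM-prim-bnk-2-g25-ROBUST-MATCHING.md`).  No `sorry`, standard axioms.

**THEOREM A (`exists_robust_matching`).**  For every finite `ι`, twist `τ ⊆ ι`, sub-cube `s`, up-sets `G, H ⊆ 𝒫(ι)` and EVERY
side function `σ : 𝒫(ι) → {a,b}` there is a bijection from the faces with layer `c ∈ G` and copy `a ∉ H` onto the faces with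
`c ∉ H` and `σ(c)`-copy `∈ G`, increasing for the copy order `a ⊆ a′, b ⊆ b′`.  (The adversary chooses, layer by layer, on WHICH
copy the target test is made.)  This file: the induction step at a TWISTED coordinate (`e ∈ τ`, local poset `Λ`: the private
targets of the states "`e ∉ a`"/"`e ∉ b`" are filled through the two-thread lemma applied to `(G,H¹;σ¹) ⊆ (G¹,H¹;σ¹)`, everything
else goes to the shared pool "`e ∉ c`" through `(G¹,H;σ)`), and the induction over the coordinates (`Finset.induction`).
It contains the column/fibre Ahlswede–Daykin moves and "Theorem U" of `…VOrderNested` (`σ` constant) and proves g24's robust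
conjectures (RU)/(RUGH2) whenever one side function is constant; consequences for CONJ V in `…ThreePartitionVOrderReverseNested`.
Executable blueprint: `run/shared/lean/prim/prim-l12/prim-bnk-2/code/g25/construct.py`. [this work]
-/

namespace Summit.CriticalPhenomena.PercolationContinuityZ3.Theorems.ThreePartition

open Finset Function
open scoped Classical

noncomputable section

variable {ι : Type*} [Fintype ι]

/-! ## The induction step at a TWISTED coordinate -/

section StepT

variable (τ : Set ι) {s' : Finset ι} {e : ι}

/-- **Induction step of THEOREM A at a twisted coordinate** (`e ∈ τ`, `e ∉ s'`): from the three section instances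
`(G¹,H;σ)`, `(G,H¹;σ¹)`, `(G¹,H¹;σ¹)` on `s'` to the instance `(G,H;σ)` on `insert e s'` (memo §2 (T): the private targets of
the states "`e ∉ a`" / "`e ∉ b`" are filled by the two-thread lemma applied to the core `(G,H¹;σ¹)` and the enlarged
`(G¹,H¹;σ¹)`; all remaining sources go to the shared pool "`e ∉ c`" through the matching of `(G¹,H;σ)`). [this work] -/
theorem step_twisted (he : e ∉ s') (heτ : e ∈ τ) {G H : Set (Set ι)} (hG : IsUpperSet G) (hH : IsUpperSet H)
    (σ : Set ι → Bool)
    (ihK : ∃ f : (ι → Fin 3) → (ι → Fin 3),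
      Set.BijOn f ↑(Nfam τ s' ((fun u : Set ι => insert e u) ⁻¹' G) H)
        ↑(Pfam τ s' H ((fun u : Set ι => insert e u) ⁻¹' G) ((fun u : Set ι => insert e u) ⁻¹' G) σ) ∧
      ∀ ω ∈ Nfam τ s' ((fun u : Set ι => insert e u) ⁻¹' G) H, f ω ∈ above τ s' ω)
    (ih0 : ∃ f : (ι → Fin 3) → (ι → Fin 3),
      Set.BijOn f ↑(Nfam τ s' G ((fun u : Set ι => insert e u) ⁻¹' H))
        ↑(Pfam τ s' ((fun u : Set ι => insert e u) ⁻¹' H) G G (fun c => σ (insert e c))) ∧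
      ∀ ω ∈ Nfam τ s' G ((fun u : Set ι => insert e u) ⁻¹' H), f ω ∈ above τ s' ω)
    (ih1 : ∃ f : (ι → Fin 3) → (ι → Fin 3),
      Set.BijOn f ↑(Nfam τ s' ((fun u : Set ι => insert e u) ⁻¹' G) ((fun u : Set ι => insert e u) ⁻¹' H))
        ↑(Pfam τ s' ((fun u : Set ι => insert e u) ⁻¹' H) ((fun u : Set ι => insert e u) ⁻¹' G)
          ((fun u : Set ι => insert e u) ⁻¹' G) (fun c => σ (insert e c))) ∧
      ∀ ω ∈ Nfam τ s' ((fun u : Set ι => insert e u) ⁻¹' G) ((fun u : Set ι => insert e u) ⁻¹' H),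
        f ω ∈ above τ s' ω) :
    ∃ f : (ι → Fin 3) → (ι → Fin 3), Set.BijOn f ↑(Nfam τ (insert e s') G H) ↑(Pfam τ (insert e s') H G G σ) ∧
      ∀ ω ∈ Nfam τ (insert e s') G H, f ω ∈ above τ (insert e s') ω := by
  obtain ⟨K, hK, hKm⟩ := ihK
  obtain ⟨f0, h0, h0m⟩ := ih0
  obtain ⟨f1, h1, h1m⟩ := ih1
  set G1 : Set (Set ι) := (fun u : Set ι => insert e u) ⁻¹' G with hG1
  set H1 : Set (Set ι) := (fun u : Set ι => insert e u) ⁻¹' H with hH1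
  set σ1 : Set ι → Bool := fun c => σ (insert e c) with hσ1
  have hG1u : IsUpperSet G1 := isUpperSet_preimage_insert hG e
  have hH1u : IsUpperSet H1 := isUpperSet_preimage_insert hH e
  set N01 := Nfam τ s' G H1 with hN01
  set N11 := Nfam τ s' G1 H1 with hN11
  set N10 := Nfam τ s' G1 H with hN10
  set P011 := Pfam τ s' H1 G G σ1 with hP011
  set P111 := Pfam τ s' H1 G1 G1 σ1 with hP111
  set P10 := Pfam τ s' H G1 G1 σ with hP10
  set Qa := Pfam τ s' H1 G G1 σ1 with hQa
  set Qb := Pfam τ s' H1 G1 G σ1 with hQb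
  have hN1 : N01 ⊆ N11 := Nfam_mono_G τ s' e hG
  have hN2 : N11 ⊆ N10 := Nfam_mono_H τ s' e hH
  set D := N11 \ N01 with hD
  set Xa := (P111 \ P011).filter (fun ω => σ1 (cp τ s' 2 ω) = false) with hXa
  set Xb := (P111 \ P011).filter (fun ω => σ1 (cp τ s' 2 ω) = true) with hXb
  have hNDun : N01 ∪ D = N11 := Finset.union_sdiff_of_subset hN1
  have hPsplit : P011 ∪ Xb ∪ Xa = P111 := by
    rw [Finset.union_assoc, Finset.union_comm Xb Xa, ← Finset.union_assoc]; exact Pfam_split τ s' e σ1 hG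
  have hQaeq : P011 ∪ Xb = Qa := Pfam_thread_b τ s' e σ1 hG
  have hQbeq : P011 ∪ Xa = Qb := Pfam_thread_a τ s' e σ1 hG
  have hND : Disjoint N01 D := Finset.disjoint_sdiff
  have hPXa : Disjoint P011 Xa := Finset.disjoint_of_subset_right (Finset.filter_subset _ _) Finset.disjoint_sdiff
  have hPXb : Disjoint P011 Xb := Finset.disjoint_of_subset_right (Finset.filter_subset _ _) Finset.disjoint_sdiff
  have hab : Disjoint Xb Xa := by
    rw [Finset.disjoint_left]; intro ω hb ha
    rw [Finset.mem_filter] at ha hb; rw [ha.2] at hb; exact Bool.false_ne_true hb.2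
  have h1' : Set.BijOn f1 ↑(N01 ∪ D) ↑(P011 ∪ Xb ∪ Xa) := by rw [hNDun, hPsplit]; exact h1
  obtain ⟨Da, Db, α, β, hDab, hdisj, hα, hβ, hαm, hβm⟩ :=
    two_thread_rel N01 P011 D Xb Xa f0 f1 (fun x y => y ∈ above τ s' x) hND hPXb hPXa hab h0 h1' h0m
      (fun x hx => h1m x (by rw [hNDun] at hx; exact hx))
  rw [hQaeq] at hα; rw [hQbeq] at hβ
  have hDaD : Da ⊆ D := by rw [← hDab]; exact Finset.subset_union_left
  have hDbD : Db ⊆ D := by rw [← hDab]; exact Finset.subset_union_right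
  -- the glued map
  let f : (ι → Fin 3) → (ι → Fin 3) := fun ω =>
    if ω e = 2 then update (K (update ω e 0)) e 2
    else if ω e = 0 then
      (if update ω e 0 ∈ N01 ∪ Da then update (α (update ω e 0)) e 0 else update (K (update ω e 0)) e 2)
    else (if update ω e 0 ∈ N01 ∪ Db then update (β (update ω e 0)) e 1 else update (K (update ω e 0)) e 2)
  have hfA : ∀ ω : ι → Fin 3, ω e = 0 → update ω e 0 ∈ N01 ∪ Da → f ω = update (α (update ω e 0)) e 0 :=
    fun ω h hm => by simp only [f, h, hm]; simp
  have hfB : ∀ ω : ι → Fin 3, ω e = 1 → update ω e 0 ∈ N01 ∪ Db → f ω = update (β (update ω e 0)) e 1 :=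
    fun ω h hm => by simp only [f, h, hm]; simp
  have hfC2 : ∀ ω : ι → Fin 3, ω e = 2 → f ω = update (K (update ω e 0)) e 2 := fun ω h => by simp only [f, h]; simp
  have hfC0 : ∀ ω : ι → Fin 3, ω e = 0 → update ω e 0 ∉ N01 ∪ Da → f ω = update (K (update ω e 0)) e 2 :=
    fun ω h hm => by simp only [f, h, hm]; simp
  have hfC1 : ∀ ω : ι → Fin 3, ω e = 1 → update ω e 0 ∉ N01 ∪ Db → f ω = update (K (update ω e 0)) e 2 :=
    fun ω h hm => by simp only [f, h, hm]; simp
  have h3 : ∀ k : Fin 3, k = 0 ∨ k = 1 ∨ k = 2 := by decide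
  have hωeq : ∀ ω : ι → Fin 3, update (update ω e 0) e (ω e) = ω := fun ω => update_update_eq_self ω
  set N := Nfam τ (insert e s') G H with hN
  set P := Pfam τ (insert e s') H G G σ with hP
  have hfaN : ∀ ω ∈ N, update ω e 0 ∈ faces s' := fun ω hω => faces_update_zero he (faces_of_mem_Nfam τ G H hω)
  have hfaP : ∀ π ∈ P, update π e 0 ∈ faces s' := fun π hπ => faces_update_zero he (faces_of_mem_Pfam τ H G G σ hπ)
  -- source classification
  have hs0 : ∀ ω ∈ N, ω e = 0 → update ω e 0 ∈ N10 := fun ω hω h0 => by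
    have h := hω; rw [← hωeq ω, h0] at h; exact (mem_Nfam_ext0_tw τ G H he heτ (hfaN ω hω)).1 h
  have hs1 : ∀ ω ∈ N, ω e = 1 → update ω e 0 ∈ N11 := fun ω hω h1 => by
    have h := hω; rw [← hωeq ω, h1] at h; exact (mem_Nfam_ext1_tw τ G H he heτ (hfaN ω hω)).1 h
  have hs2 : ∀ ω ∈ N, ω e = 2 → update ω e 0 ∈ N01 := fun ω hω h2 => by
    have h := hω; rw [← hωeq ω, h2] at h; exact (mem_Nfam_ext2_tw τ G H he heτ (hfaN ω hω)).1 h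
  -- target classification
  have ht0 : ∀ y ∈ Qa, update y e 0 ∈ P := fun y hy =>
    (mem_Pfam_ext0_tw τ H G G σ he heτ (faces_of_mem_Pfam τ H1 G G1 σ1 hy)).2 hy
  have ht1 : ∀ y ∈ Qb, update y e 1 ∈ P := fun y hy =>
    (mem_Pfam_ext1_tw τ H G G σ he heτ (faces_of_mem_Pfam τ H1 G1 G σ1 hy)).2 hy
  have ht2 : ∀ y ∈ P10, update y e 2 ∈ P := fun y hy =>
    (mem_Pfam_ext2_tw τ H G G σ he heτ (faces_of_mem_Pfam τ H G1 G1 σ hy)).2 hy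
  have hu0 : ∀ π ∈ P, π e = 0 → update π e 0 ∈ Qa := fun π hπ h0 => by
    have h := hπ; rw [← hωeq π, h0] at h; exact (mem_Pfam_ext0_tw τ H G G σ he heτ (hfaP π hπ)).1 h
  have hu1 : ∀ π ∈ P, π e = 1 → update π e 0 ∈ Qb := fun π hπ h1 => by
    have h := hπ; rw [← hωeq π, h1] at h; exact (mem_Pfam_ext1_tw τ H G G σ he heτ (hfaP π hπ)).1 h
  have hu2 : ∀ π ∈ P, π e = 2 → update π e 0 ∈ P10 := fun π hπ h2 => by
    have h := hπ; rw [← hωeq π, h2] at h; exact (mem_Pfam_ext2_tw τ H G G σ he heτ (hfaP π hπ)).1 h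
  -- bookkeeping
  have hDN : ∀ x ∈ D, x ∉ N01 := fun x hx => (Finset.mem_sdiff.1 hx).2
  have hDN11 : ∀ x ∈ D, x ∈ N11 := fun x hx => (Finset.mem_sdiff.1 hx).1
  have hDaDb : ∀ x ∈ Da, x ∉ Db := fun x hx h => Finset.disjoint_left.1 hdisj hx h
  have hAdom : ∀ x ∈ N01 ∪ Da, x ∈ N10 := fun x hx => by
    rcases Finset.mem_union.1 hx with h | h
    · exact hN2 (hN1 h)
    · exact hN2 (hDN11 _ (hDaD h))
  have hBdom : ∀ x ∈ N01 ∪ Db, x ∈ N11 := fun x hx => by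
    rcases Finset.mem_union.1 hx with h | h
    · exact hN1 h
    · exact hDN11 _ (hDbD h)
  -- classification of the glued map on sources
  have hclass : ∀ ω ∈ N,
      (f ω = update (α (update ω e 0)) e 0 ∧ update ω e 0 ∈ N01 ∪ Da ∧ ω e = 0) ∨
      (f ω = update (β (update ω e 0)) e 1 ∧ update ω e 0 ∈ N01 ∪ Db ∧ ω e = 1) ∨
      (f ω = update (K (update ω e 0)) e 2 ∧ update ω e 0 ∈ N10 ∧
        (ω e = 2 ∧ update ω e 0 ∈ N01 ∨ ω e = 0 ∧ update ω e 0 ∉ N01 ∪ Da ∨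
          ω e = 1 ∧ update ω e 0 ∉ N01 ∪ Db ∧ update ω e 0 ∈ N11)) := by
    intro ω hω
    rcases h3 (ω e) with h | h | h
    · by_cases hm : update ω e 0 ∈ N01 ∪ Da
      · left; exact ⟨hfA ω h hm, hm, h⟩
      · right; right; exact ⟨hfC0 ω h hm, hs0 ω hω h, Or.inr (Or.inl ⟨h, hm⟩)⟩
    · by_cases hm : update ω e 0 ∈ N01 ∪ Db
      · right; left; exact ⟨hfB ω h hm, hm, h⟩
      · right; right; exact ⟨hfC1 ω h hm, hN2 (hs1 ω hω h), Or.inr (Or.inr ⟨h, hm, hs1 ω hω h⟩)⟩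
    · right; right; exact ⟨hfC2 ω h, hN2 (hN1 (hs2 ω hω h)), Or.inl ⟨h, hs2 ω hω h⟩⟩
  have faα : ∀ x ∈ N01 ∪ Da, α x ∈ faces s' := fun x hx =>
    faces_of_mem_Pfam τ H1 G G1 σ1 (by exact_mod_cast hα.mapsTo (by exact_mod_cast hx))
  have faβ : ∀ x ∈ N01 ∪ Db, β x ∈ faces s' := fun x hx =>
    faces_of_mem_Pfam τ H1 G1 G σ1 (by exact_mod_cast hβ.mapsTo (by exact_mod_cast hx))
  have faK : ∀ x ∈ N10, K x ∈ faces s' := fun x hx =>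
    faces_of_mem_Pfam τ H G1 G1 σ (by exact_mod_cast hK.mapsTo (by exact_mod_cast hx))
  refine ⟨f, Set.BijOn.mk ?_ ?_ ?_, ?_⟩
  · -- MapsTo
    intro ω hω
    have hω' : ω ∈ N := by exact_mod_cast hω
    rcases hclass ω hω' with ⟨hfe, hmem, -⟩ | ⟨hfe, hmem, -⟩ | ⟨hfe, hmem, -⟩
    · rw [hfe]; exact_mod_cast ht0 _ (hα.mapsTo (by exact_mod_cast hmem))
    · rw [hfe]; exact_mod_cast ht1 _ (hβ.mapsTo (by exact_mod_cast hmem))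
    · rw [hfe]; exact_mod_cast ht2 _ (hK.mapsTo (by exact_mod_cast hmem))
  · -- InjOn
    intro ω₁ hω₁ ω₂ hω₂ hfeq
    have hω₁' : ω₁ ∈ N := by exact_mod_cast hω₁
    have hω₂' : ω₂ ∈ N := by exact_mod_cast hω₂
    have key : update ω₁ e 0 = update ω₂ e 0 → ω₁ e = ω₂ e → ω₁ = ω₂ := fun hr hs => by
      rw [← hωeq ω₁, ← hωeq ω₂, hr, hs]
    rcases hclass ω₁ hω₁' with ⟨hf₁, hm₁, ht₁⟩ | ⟨hf₁, hm₁, ht₁⟩ | ⟨hf₁, hm₁, ht₁⟩ <;>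
      rcases hclass ω₂ hω₂' with ⟨hf₂, hm₂, ht₂⟩ | ⟨hf₂, hm₂, ht₂⟩ | ⟨hf₂, hm₂, ht₂⟩ <;>
      rw [hf₁, hf₂] at hfeq
    · obtain ⟨-, hxy⟩ := update_inj_of_isFace he (faα _ hm₁) (faα _ hm₂) hfeq
      exact key (hα.injOn (by exact_mod_cast hm₁) (by exact_mod_cast hm₂) hxy) (by rw [ht₁, ht₂])
    · exact absurd (update_inj_of_isFace he (faα _ hm₁) (faβ _ hm₂) hfeq).1 (by decide)
    · exact absurd (update_inj_of_isFace he (faα _ hm₁) (faK _ hm₂) hfeq).1 (by decide)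
    · exact absurd (update_inj_of_isFace he (faβ _ hm₁) (faα _ hm₂) hfeq).1 (by decide)
    · obtain ⟨-, hxy⟩ := update_inj_of_isFace he (faβ _ hm₁) (faβ _ hm₂) hfeq
      exact key (hβ.injOn (by exact_mod_cast hm₁) (by exact_mod_cast hm₂) hxy) (by rw [ht₁, ht₂])
    · exact absurd (update_inj_of_isFace he (faβ _ hm₁) (faK _ hm₂) hfeq).1 (by decide)
    · exact absurd (update_inj_of_isFace he (faK _ hm₁) (faα _ hm₂) hfeq).1 (by decide)
    · exact absurd (update_inj_of_isFace he (faK _ hm₁) (faβ _ hm₂) hfeq).1 (by decide)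
    · obtain ⟨-, hxy⟩ := update_inj_of_isFace he (faK _ hm₁) (faK _ hm₂) hfeq
      have hr : update ω₁ e 0 = update ω₂ e 0 := hK.injOn (by exact_mod_cast hm₁) (by exact_mod_cast hm₂) hxy
      refine key hr ?_
      rcases ht₁ with ⟨h₁, m₁⟩ | ⟨h₁, m₁⟩ | ⟨h₁, m₁, n₁⟩ <;> rcases ht₂ with ⟨h₂, m₂⟩ | ⟨h₂, m₂⟩ | ⟨h₂, m₂, n₂⟩
      · rw [h₁, h₂]
      · exact absurd (Finset.mem_union_left _ (hr ▸ m₁)) m₂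
      · exact absurd (Finset.mem_union_left _ (hr ▸ m₁)) m₂
      · exact absurd (Finset.mem_union_left _ (hr ▸ m₂)) m₁
      · rw [h₁, h₂]
      · -- state 0 (not in N01 ∪ Da) vs state 1 (not in N01 ∪ Db, in N11): the common face lies in D = Da ∪ Db
        exfalso
        have hx : update ω₂ e 0 ∈ D := Finset.mem_sdiff.2 ⟨n₂, fun h => m₂ (Finset.mem_union_left _ h)⟩
        rw [← hDab] at hx
        rcases Finset.mem_union.1 hx with h | h
        · exact m₁ (Finset.mem_union_right _ (hr ▸ h))
        · exact m₂ (Finset.mem_union_right _ h)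
      · exact absurd (Finset.mem_union_left _ (hr ▸ m₂)) m₁
      · exfalso
        have hx : update ω₁ e 0 ∈ D := Finset.mem_sdiff.2 ⟨n₁, fun h => m₁ (Finset.mem_union_left _ h)⟩
        rw [← hDab] at hx
        rcases Finset.mem_union.1 hx with h | h
        · exact m₂ (Finset.mem_union_right _ (hr ▸ h))
        · exact m₁ (Finset.mem_union_right _ h)
      · rw [h₁, h₂]
  · -- SurjOn
    intro π hπ
    have hπ' : π ∈ P := by exact_mod_cast hπ
    rcases h3 (π e) with h | h | h
    · obtain ⟨x, hx, hxe⟩ := hα.surjOn (by exact_mod_cast hu0 π hπ' h : update π e 0 ∈ (↑Qa : Set (ι → Fin 3)))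
      have hx' : x ∈ N01 ∪ Da := by exact_mod_cast hx
      have hxf : x ∈ faces s' := faces_of_mem_Nfam τ G1 H (hAdom x hx')
      have hxu : update x e 0 = x := update_eq_self_of_faces he hxf
      refine ⟨update x e 0, by exact_mod_cast (mem_Nfam_ext0_tw τ G H he heτ hxf).2 (hAdom x hx'), ?_⟩
      rw [hfA _ (by rw [update_self]) (by rw [update_idem, hxu]; exact hx'), update_idem, hxu, hxe,
        update_update_of_apply_eq π h]
    · obtain ⟨x, hx, hxe⟩ := hβ.surjOn (by exact_mod_cast hu1 π hπ' h : update π e 0 ∈ (↑Qb : Set (ι → Fin 3)))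
      have hx' : x ∈ N01 ∪ Db := by exact_mod_cast hx
      have hxf : x ∈ faces s' := faces_of_mem_Nfam τ G1 H1 (hBdom x hx')
      have hxu : update x e 0 = x := update_eq_self_of_faces he hxf
      refine ⟨update x e 1, by exact_mod_cast (mem_Nfam_ext1_tw τ G H he heτ hxf).2 (hBdom x hx'), ?_⟩
      rw [hfB _ (by rw [update_self]) (by rw [update_idem, hxu]; exact hx'), update_idem, hxu, hxe,
        update_update_of_apply_eq π h]
    · obtain ⟨x, hx, hxe⟩ := hK.surjOn (by exact_mod_cast hu2 π hπ' h : update π e 0 ∈ (↑P10 : Set (ι → Fin 3)))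
      have hx' : x ∈ N10 := by exact_mod_cast hx
      have hxf : x ∈ faces s' := faces_of_mem_Nfam τ G1 H hx'
      have hxu : update x e 0 = x := update_eq_self_of_faces he hxf
      by_cases hx01 : x ∈ N01
      · refine ⟨update x e 2, by exact_mod_cast (mem_Nfam_ext2_tw τ G H he heτ hxf).2 hx01, ?_⟩
        rw [hfC2 _ (by rw [update_self]), update_idem, hxu, hxe, update_update_of_apply_eq π h]
      · by_cases hx11 : x ∈ N11
        · have hxD : x ∈ D := Finset.mem_sdiff.2 ⟨hx11, hx01⟩
          rw [← hDab] at hxD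
          rcases Finset.mem_union.1 hxD with hda | hdb
          · -- x ∈ Da: use the state-1 source
            have hm : x ∉ N01 ∪ Db := fun h' => (Finset.mem_union.1 h').elim hx01 (hDaDb x hda)
            refine ⟨update x e 1, by exact_mod_cast (mem_Nfam_ext1_tw τ G H he heτ hxf).2 hx11, ?_⟩
            rw [hfC1 _ (by rw [update_self]) (by rw [update_idem, hxu]; exact hm), update_idem, hxu, hxe,
              update_update_of_apply_eq π h]
          · have hm : x ∉ N01 ∪ Da := fun h' => (Finset.mem_union.1 h').elim hx01 (fun h'' => hDaDb x h'' hdb)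
            refine ⟨update x e 0, by exact_mod_cast (mem_Nfam_ext0_tw τ G H he heτ hxf).2 hx', ?_⟩
            rw [hfC0 _ (by rw [update_self]) (by rw [update_idem, hxu]; exact hm), update_idem, hxu, hxe,
              update_update_of_apply_eq π h]
        · have hm : x ∉ N01 ∪ Da := fun h' => (Finset.mem_union.1 h').elim hx01 (fun h'' => hx11 (hDN11 _ (hDaD h'')))
          refine ⟨update x e 0, by exact_mod_cast (mem_Nfam_ext0_tw τ G H he heτ hxf).2 hx', ?_⟩
          rw [hfC0 _ (by rw [update_self]) (by rw [update_idem, hxu]; exact hm), update_idem, hxu, hxe,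
            update_update_of_apply_eq π h]
  · -- monotone
    intro ω hω
    rcases hclass ω hω with ⟨hfe, hmem, htag⟩ | ⟨hfe, hmem, htag⟩ | ⟨hfe, hmem, htag⟩
    · refine mem_above_insert_of τ he ?_ ?_ ?_
      · rw [hfe, update_idem, update_eq_self_of_faces he (faα _ hmem)]; exact hαm _ hmem
      · intro h0; exfalso; rw [htag] at h0; exact (h0.1 rfl) heτ
      · intro _; rw [hfe, update_self]; simp [heτ]
    · refine mem_above_insert_of τ he ?_ ?_ ?_
      · rw [hfe, update_idem, update_eq_self_of_faces he (faβ _ hmem)]; exact hβm _ hmem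
      · intro _; rw [hfe, update_self]; simp [heτ]
      · intro h1; exfalso; rw [htag] at h1; exact (h1.1 rfl) heτ
    · refine mem_above_insert_of τ he ?_ ?_ ?_
      · rw [hfe, update_idem, update_eq_self_of_faces he (faK _ hmem)]; exact hKm _ hmem
      · intro _; rw [hfe, update_self]; simp [heτ]
      · intro _; rw [hfe, update_self]; simp [heτ]

end StepT

/-! ## THEOREM A (constant source side `a`): the robust matching exists on every sub-cube -/

section Main

variable (τ : Set ι)

omit [Fintype ι] in
/-- Copies of faces of the empty cube are empty. [this work] -/
theorem cp_empty (j : Fin 3) (ω : ι → Fin 3) : cp τ ∅ j ω = ∅ := by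
  ext i; simp [mem_cp]

/-- Base case: on the empty cube the source and target families coincide. [this work] -/
theorem Nfam_empty_eq_Pfam (G H : Set (Set ι)) (σ : Set ι → Bool) : Nfam τ ∅ G H = Pfam τ ∅ H G G σ := by
  ext ω
  rw [mem_Nfam, mem_Pfam, cp_empty, cp_empty, cp_empty]
  constructor
  · rintro ⟨hf, hG, hH⟩; refine ⟨hf, hH, ?_⟩; split_ifs <;> exact hG
  · rintro ⟨hf, hH, hG⟩; refine ⟨hf, ?_, hH⟩; split_ifs at hG <;> exact hG

/-- **THEOREM A** (prim-bnk-2 g25; one-sided robust Kleitman–Hall matching on the face poset of a cube, constant source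
side `a`).  For every sub-cube `s`, every twist `τ`, all up-sets `G, H ⊆ 𝒫(ι)` and EVERY side function `σ : 𝒫(ι) → {a,b}`
there is a bijection from the faces `{c ∈ G, a ∉ H}` onto the faces `{c ∉ H, σ(c)-copy ∈ G}` which is increasing for the
copy order (`a ⊆ a′`, `b ⊆ b′`).  Proof: induction on `s` by `step_untwisted` / `step_twisted` (three instances of the
induction hypothesis per coordinate, glued by the two-thread lemma); base case `Nfam_empty_eq_Pfam`.  Consequences
(file `…ThreePartitionVOrderReverseNested`): the `triT` inequality `#(𝒳 ∩ N) ≤ #(𝒳 ∩ P)` for copy-order up-sets `𝒳`, containing the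
column/fibre moves and Theorem U of `…VOrderNested`, and CONJ V for reverse-nested pairs. [this work] -/
theorem exists_robust_matching (s : Finset ι) :
    ∀ (G H : Set (Set ι)), IsUpperSet G → IsUpperSet H → ∀ σ : Set ι → Bool,
      ∃ f : (ι → Fin 3) → (ι → Fin 3), Set.BijOn f ↑(Nfam τ s G H) ↑(Pfam τ s H G G σ) ∧
        ∀ ω ∈ Nfam τ s G H, f ω ∈ above τ s ω := by
  induction s using Finset.induction_on with
  | empty =>
    intro G H hG hH σ
    refine ⟨id, ?_, fun ω _ => mem_above_self τ ∅ ω⟩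
    rw [← Nfam_empty_eq_Pfam τ G H σ]; exact Set.bijOn_id _
  | insert e s' he ih =>
    intro G H hG hH σ
    have hG1 : IsUpperSet ((fun u : Set ι => insert e u) ⁻¹' G) := isUpperSet_preimage_insert hG e
    have hH1 : IsUpperSet ((fun u : Set ι => insert e u) ⁻¹' H) := isUpperSet_preimage_insert hH e
    by_cases heτ : e ∈ τ
    · exact step_twisted τ he heτ hG hH σ (ih _ _ hG1 hH σ) (ih _ _ hG hH1 _) (ih _ _ hG1 hH1 _)
    · exact step_untwisted τ he heτ hG hH σ (ih _ _ hG hH1 _) (ih _ _ hG hH σ) (ih _ _ hG1 hH σ)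

end Main

end

end Summit.CriticalPhenomena.PercolationContinuityZ3.Theorems.ThreePartition
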